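import Mathlib.Analysis.SpecialFunctions.Trigonometric.Deriv
import Mathlib.Analysis.Calculus.Deriv.MeanValue
import HarnessLib

/-!
# Global alternating Taylor bounds for the cosine (all orders)

For `M : ℕ` let `T_M(y) = ∑_{i=0}^{M} (-1)^i y^{2i}/(2i)!` be the Taylor polynomial of `cos` of
degree `2M`. For EVERY real `y`:

* `cos y ≤ T_M(y)` if `M` is even (`M = 0`: `cos ≤ 1`; `M = 2`: `cos y ≤ 1 - y²/2 + y⁴/24`),
* `T_M(y) ≤ cos y` if `M` is odd (`M = 1`: `1 - y²/2 ≤ cos y`, Mathlib's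
  `Real.one_sub_sq_div_two_le_cos`),

and the companion bounds for `sin` against `S_M(y) = ∑_{i ≤ M} (-1)^i y^{2i+1}/(2i+1)!` on
`[0, ∞)`. Proof (the classical successive-integration induction, here via monotonicity): if
`(-1)^M (T_M - cos) ≥ 0` on `ℝ` then `(-1)^M (S_M - sin) ≥ 0` on `[0, ∞)` (its derivative is
`(-1)^M (T_M - cos)`, its value at `0` is `0`), hence `(-1)^{M+1} (T_{M+1} - cos) ≥ 0` on `[0, ∞)`
(derivative `(-1)^M (S_M - sin)`, value `0` at `0`), and on all of `ℝ` by evenness.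

These "global Taylor inequalities" are the soundness mechanism of every Taylor-minorant
certificate of farness from a lattice: Aharonov–Regev use `M = 1` (`cos x ≥ 1 - x²/2`, §6.1),
Aggarwal et al. the order-`k` expansion (arXiv:2211.11693, pp. 9–10). They serve
`DualPhaseBranchingRefutation.lean` (soundness of the leaves) and the route crux
`TaylorMinorantsBuySqrtK` (`Summits/PneNP/PneNP/Theses/LatticeMagic.lean`), whose statement contains
literally the sum `∑ i ∈ Finset.range (M + 1), (-1) ^ i * y ^ (2 * i) / (2 * i)!`; for that reason
the statements below are kept DEFINITION-FREE (raw finite sums, same parenthesisation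
`(-1) ^ i * y ^ (2 * i) / ↑(2 * i)!`), so that they rewrite that sum verbatim. The last lemma
packages the PARITY RULE of such certificates (`c ≥ 0 ⇒ M` odd, `c < 0 ⇒ M` even, hence
`c · T_M ≤ c · cos`).

Mathlib (searched `cos_bound`, `one_sub_sq_div_two_le_cos`, `taylor` × `cos`): only `M ≤ 1` and the
local remainder estimate `Real.cos_bound` (`|x| ≤ 1`); the tree has the fixed orders 2, 3, 4 on
`[0, ∞)` (`KLSNumerics.cos_le_taylor_four`, `taylor_six_le_cos`, `cos_le_taylor_eight`).

## References

* [folklore] alternating Taylor (Leibniz-type) bounds for `cos` and `sin`.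
* D. Aharonov, O. Regev, *Lattice problems in NP ∩ coNP*, J. ACM 52 (2005), §6.1.
* D. Aggarwal, H. Bennett, Z. Brakerski, A. Golovnev, R. Kumar, Z. Li, S. Peters,
  N. Stephens-Davidowitz, V. Vaikuntanathan, *Lattice problems beyond polynomial time*,
  arXiv:2211.11693 (STOC 2023), pp. 9–10.
-/

noncomputable section

open Real Finset

namespace Literature.Computability.MetaComplexity

/-- Termwise derivative of the Taylor sums: `d/dy [c · y^(k+1)/(k+1)!] = c · y^k/k!`. [folklore] -/
theorem hasDerivAt_const_mul_pow_div_factorial (c : ℝ) (k : ℕ) (y : ℝ) :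
    HasDerivAt (fun y : ℝ => c * y ^ (k + 1) / ((k + 1).factorial : ℝ))
      (c * y ^ k / (k.factorial : ℝ)) y := by
  refine (((hasDerivAt_pow (k + 1) y).const_mul c).div_const ((k + 1).factorial : ℝ)).congr_deriv ?_
  rw [Nat.factorial_succ, Nat.add_sub_cancel]
  push_cast
  have hk : (k.factorial : ℝ) ≠ 0 := by positivity
  have hk1 : ((k : ℝ) + 1) ≠ 0 := by positivity
  field_simp

/-- The sine partial sum `S_M(y) = ∑_{i ≤ M} (-1)^i y^{2i+1}/(2i+1)!` has derivative the cosine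
partial sum `T_M(y) = ∑_{i ≤ M} (-1)^i y^{2i}/(2i)!`. [folklore] -/
theorem hasDerivAt_sinTaylorSum (M : ℕ) (y : ℝ) :
    HasDerivAt
      (fun y : ℝ => ∑ i ∈ range (M + 1), (-1 : ℝ) ^ i * y ^ (2 * i + 1) / ((2 * i + 1).factorial : ℝ))
      (∑ i ∈ range (M + 1), (-1 : ℝ) ^ i * y ^ (2 * i) / ((2 * i).factorial : ℝ)) y :=
  HasDerivAt.fun_sum fun i _ => hasDerivAt_const_mul_pow_div_factorial _ (2 * i) _

/-- `T_{M+1}(y) = (∑_{i ≤ M} (-1)^{i+1} y^{2i+2}/(2i+2)!) + 1` (the constant term split off).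
[folklore] -/
theorem cosTaylorSum_succ (M : ℕ) (y : ℝ) :
    ∑ i ∈ range (M + 1 + 1), (-1 : ℝ) ^ i * y ^ (2 * i) / ((2 * i).factorial : ℝ) =
      (∑ i ∈ range (M + 1),
        (-1 : ℝ) ^ (i + 1) * y ^ (2 * i + 1 + 1) / ((2 * i + 1 + 1).factorial : ℝ)) + 1 := by
  rw [Finset.sum_range_succ']
  have h0 : (-1 : ℝ) ^ 0 * y ^ (2 * 0) / ((2 * 0).factorial : ℝ) = 1 := by simp
  rw [h0, add_left_inj]
  refine Finset.sum_congr rfl fun i _ => ?_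
  rw [show 2 * (i + 1) = 2 * i + 1 + 1 by ring]

/-- The cosine partial sum `T_{M+1}` has derivative `-S_M`. [folklore] -/
theorem hasDerivAt_cosTaylorSum_succ (M : ℕ) (y : ℝ) :
    HasDerivAt
      (fun y : ℝ => ∑ i ∈ range (M + 1 + 1), (-1 : ℝ) ^ i * y ^ (2 * i) / ((2 * i).factorial : ℝ))
      (-(∑ i ∈ range (M + 1), (-1 : ℝ) ^ i * y ^ (2 * i + 1) / ((2 * i + 1).factorial : ℝ))) y := by
  have hfun :
      (fun y : ℝ => ∑ i ∈ range (M + 1 + 1), (-1 : ℝ) ^ i * y ^ (2 * i) / ((2 * i).factorial : ℝ)) =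
        fun y => (∑ i ∈ range (M + 1),
          (-1 : ℝ) ^ (i + 1) * y ^ (2 * i + 1 + 1) / ((2 * i + 1 + 1).factorial : ℝ)) + 1 :=
    funext (cosTaylorSum_succ M)
  rw [hfun, ← Finset.sum_neg_distrib]
  refine (HasDerivAt.fun_sum fun i _ => ?_).add_const 1
  exact (hasDerivAt_const_mul_pow_div_factorial ((-1 : ℝ) ^ (i + 1)) (2 * i + 1) y).congr_deriv
    (by ring)

/-- Monotonicity step: a function with `f 0 = 0` and derivative `≥ 0` on `[0, ∞)` is `≥ 0` on
`[0, ∞)`. [folklore] -/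
theorem nonneg_of_hasDerivAt_of_nonneg {f f' : ℝ → ℝ} (hf : ∀ y, HasDerivAt f (f' y) y)
    (hf' : ∀ y, 0 ≤ y → 0 ≤ f' y) (h0 : f 0 = 0) {y : ℝ} (hy : 0 ≤ y) : 0 ≤ f y := by
  have hmono : MonotoneOn f (Set.Ici 0) :=
    monotoneOn_of_deriv_nonneg (convex_Ici 0) (fun x _ => (hf x).continuousAt.continuousWithinAt)
      (fun x _ => (hf x).differentiableAt.differentiableWithinAt) fun x hx => by
        rw [interior_Ici, Set.mem_Ioi] at hx
        rw [(hf x).deriv]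
        exact hf' x hx.le
  simpa only [h0] using hmono (Set.mem_Ici.2 le_rfl) (Set.mem_Ici.2 hy) hy

/-- **The alternating Taylor bounds, signed form**: `(-1)^M · (T_M(y) - cos y) ≥ 0` for every order
`M` and every real `y`. Induction on `M` through the sine partial sums, as in the module docstring.
[folklore] -/
theorem neg_one_pow_mul_cosTaylorSum_sub_cos_nonneg (M : ℕ) (y : ℝ) :
    0 ≤ (-1 : ℝ) ^ M *
      ((∑ i ∈ range (M + 1), (-1 : ℝ) ^ i * y ^ (2 * i) / ((2 * i).factorial : ℝ)) - cos y) := by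
  induction M generalizing y with
  | zero => simp [cos_le_one]
  | succ M ih =>
    -- (i) the sine step on `[0, ∞)`: `(-1)^M (S_M - sin) ≥ 0`
    have hS : ∀ y : ℝ, 0 ≤ y → 0 ≤ (-1 : ℝ) ^ M *
        ((∑ i ∈ range (M + 1), (-1 : ℝ) ^ i * y ^ (2 * i + 1) / ((2 * i + 1).factorial : ℝ)) -
          sin y) := fun y hy =>
      nonneg_of_hasDerivAt_of_nonneg
        (fun y => ((hasDerivAt_sinTaylorSum M y).sub (hasDerivAt_sin y)).const_mul _)
        (fun y _ => ih y) (by simp [pow_succ]) hy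
    -- (ii) the cosine step on `[0, ∞)`: `(-1)^(M+1) (T_{M+1} - cos) ≥ 0`
    have hC : ∀ y : ℝ, 0 ≤ y → 0 ≤ (-1 : ℝ) ^ (M + 1) *
        ((∑ i ∈ range (M + 1 + 1), (-1 : ℝ) ^ i * y ^ (2 * i) / ((2 * i).factorial : ℝ)) -
          cos y) := fun y hy =>
      nonneg_of_hasDerivAt_of_nonneg
        (fun y => (((hasDerivAt_cosTaylorSum_succ M y).sub (hasDerivAt_cos y)).const_mul
          ((-1 : ℝ) ^ (M + 1))).congr_deriv (by rw [pow_succ]; ring))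
        hS (by simp [Finset.sum_range_succ', pow_succ, pow_mul]) hy
    -- (iii) all of `ℝ` by evenness
    rcases le_or_gt 0 y with hy | hy
    · exact hC y hy
    · have h := hC (-y) (by linarith)
      simpa only [Even.neg_pow (even_two_mul _), cos_neg] using h

/-- **Even order: `cos y ≤ T_M(y)` for all real `y`** (`M = 0, 2, 4, …`). [folklore] -/
theorem cos_le_cosTaylorSum {M : ℕ} (hM : Even M) (y : ℝ) :
    cos y ≤ ∑ i ∈ range (M + 1), (-1 : ℝ) ^ i * y ^ (2 * i) / ((2 * i).factorial : ℝ) := by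
  have h := neg_one_pow_mul_cosTaylorSum_sub_cos_nonneg M y
  rwa [hM.neg_one_pow, one_mul, sub_nonneg] at h

/-- **Odd order: `T_M(y) ≤ cos y` for all real `y`** (`M = 1, 3, 5, …`; `M = 1` is
`Real.one_sub_sq_div_two_le_cos`). [folklore] -/
theorem cosTaylorSum_le_cos {M : ℕ} (hM : Odd M) (y : ℝ) :
    ∑ i ∈ range (M + 1), (-1 : ℝ) ^ i * y ^ (2 * i) / ((2 * i).factorial : ℝ) ≤ cos y := by
  have h := neg_one_pow_mul_cosTaylorSum_sub_cos_nonneg M y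
  rwa [hM.neg_one_pow, neg_one_mul, neg_sub, sub_nonneg] at h

/-- The sine companions on `[0, ∞)`, signed form: `(-1)^M · (S_M(y) - sin y) ≥ 0` for `y ≥ 0`.
[folklore] -/
theorem neg_one_pow_mul_sinTaylorSum_sub_sin_nonneg (M : ℕ) {y : ℝ} (hy : 0 ≤ y) :
    0 ≤ (-1 : ℝ) ^ M *
      ((∑ i ∈ range (M + 1), (-1 : ℝ) ^ i * y ^ (2 * i + 1) / ((2 * i + 1).factorial : ℝ)) -
        sin y) :=
  nonneg_of_hasDerivAt_of_nonneg
    (fun y => ((hasDerivAt_sinTaylorSum M y).sub (hasDerivAt_sin y)).const_mul _)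
    (fun y _ => neg_one_pow_mul_cosTaylorSum_sub_cos_nonneg M y) (by simp [pow_succ]) hy

/-- Even order: `sin y ≤ S_M(y)` for `y ≥ 0` (`M = 0`: `sin y ≤ y`). [folklore] -/
theorem sin_le_sinTaylorSum {M : ℕ} (hM : Even M) {y : ℝ} (hy : 0 ≤ y) :
    sin y ≤ ∑ i ∈ range (M + 1), (-1 : ℝ) ^ i * y ^ (2 * i + 1) / ((2 * i + 1).factorial : ℝ) := by
  have h := neg_one_pow_mul_sinTaylorSum_sub_sin_nonneg M hy
  rwa [hM.neg_one_pow, one_mul, sub_nonneg] at h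

/-- Odd order: `S_M(y) ≤ sin y` for `y ≥ 0` (`M = 1`: `y - y³/6 ≤ sin y`). [folklore] -/
theorem sinTaylorSum_le_sin {M : ℕ} (hM : Odd M) {y : ℝ} (hy : 0 ≤ y) :
    ∑ i ∈ range (M + 1), (-1 : ℝ) ^ i * y ^ (2 * i + 1) / ((2 * i + 1).factorial : ℝ) ≤ sin y := by
  have h := neg_one_pow_mul_sinTaylorSum_sub_sin_nonneg M hy
  rwa [hM.neg_one_pow, neg_one_mul, neg_sub, sub_nonneg] at h

/-- **The parity rule of Taylor-minorant certificates**: if `c ≥ 0 ⇒ M` odd and `c < 0 ⇒ M`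
even, then `c · T_M(y) ≤ c · cos y` for every real `y` — the pointwise inequality behind the
soundness of every order-`M` Taylor certificate of farness (Aharonov–Regev 2005 §6.1 for `M = 1`,
`c = 1/N`; Aggarwal et al. 2022, pp. 9–10, order `k`). [folklore] -/
theorem mul_cosTaylorSum_le_mul_cos {c : ℝ} {M : ℕ} (hodd : 0 ≤ c → Odd M) (heven : c < 0 → Even M)
    (y : ℝ) :
    c * ∑ i ∈ range (M + 1), (-1 : ℝ) ^ i * y ^ (2 * i) / ((2 * i).factorial : ℝ) ≤ c * cos y := by
  rcases le_or_gt 0 c with hc | hc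
  · exact mul_le_mul_of_nonneg_left (cosTaylorSum_le_cos (hodd hc) y) hc
  · exact mul_le_mul_of_nonpos_left (cos_le_cosTaylorSum (heven hc) y) hc.le

end Literature.Computability.MetaComplexity
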